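/-
Copyright (c) 2026 the pub-hodgecm-mathlib formalisation cell (harness21).  Typer∕survey seat hodgecm-mathlib-typ-T5b (g0), topic T5 = P8
«(C♯)hol interior», 2026-08-31.  KERNEL module: THEOREMS ONLY (no definition, no named fact, no instance, no notation, no `sorry`).
-/
import Literature.NumberTheory.Automorphic.Liu2021.ThetaLiftFromLineCentralCharacter
import Literature.NumberTheory.Automorphic.Liu2021.Def411ChiAutomorphicQuotientDescent
import HarnessLib

/-!
# [Liu2021, proof of Prop. 4.13 Case 1, l. 2136–2137] node B junction: the theta character of a holomorphic-cotangent `P` IS `χ̃` of a `χ ∈ Chi`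

Topic `NumberTheory/Automorphic/Liu2021`; namespace `Literature.NumberTheory.Automorphic.Liu2021`.  THEOREMS ONLY.  Cell hodgecm-mathlib
FLOOR 0, programme P2, topic T5 = P8 «(C♯)hol interior», node B of the T5-TREE — the BY-NAME junction of
★ `ThetaLiftFromLineCentralCharacter.charCM_archCentre_eq_one_of_holCotForm` («`χ̃_∞ = 1`» for the theta character meeting a
holomorphic-cotangent `P`) with ★ `Def411WeilCarriers.exists_chi_chiQuot_eq_of_archUnit` (the descent `χ̃ ↦ χ ∈ Chi`):

* `exists_chi_chiQuot_eq_of_holCotForm` — in (C♯)hol's frame, if `P ∋` the coordinates of a holomorphic cotangent form with a non-zero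
  class and `pr_P [Θ̃_Φ(χ̃) ∘ ιA] ≠ 0`, then `χ̃ = chiQuot a χ` for some `χ ∈ Chi L⁺ L c̄` (Liu's index set `E¹\(𝔸_E^∞)¹` of Def. 4.11);
* `MeetsThetaLiftFromLine.exists_chi_starProjection_ne_zero_of_holCotForm` — packaged with T5a's seam ★ `MeetsThetaLiftFromLine` and
  ★ `MeetsThetaLiftFromLine.exists_charCM_starProjection_ne_zero`: **`P` meets the theta lift from `⟨a⟩` and is holomorphic-cotangent ⇒
  for some `χ ∈ Chi L⁺ L c̄` the projection to `P` of `[Θ̃_Φ(charCM (chiQuot a χ)) ∘ ιA]` is non-zero** — the input of node B steps (3)–(4)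
  (coinvariant junction and injectivity into `HasFinComponent P (rhoAtLine … a χ)`), now indexed by a GENUINE `χ ∈ Chi`.

HONEST SCOPE.  Consumer inputs unchanged from ★ `charCM_archCentre_eq_one_of_holCotForm`: the holomorphic cotangent form `Φ_h` with ONE
coordinate class `[Φ_h(·) j] ∈ P ∖ 0` (Summit-side ★ `continuous_of_mem_cohForms` ∕ `toLp_toQuotFun_ne_zero_of_mem_cohForms` supply it from
`IsHolCotangentAt`; not imported here — Literature never imports Summits).  HC_CM is proved only modulo the printed citations until rung 0
closes; this file books nothing and discharges nothing booked.

## References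
* [Liu2021] Y. Liu, Camb. J. Math. 9 (2021), Def. 4.11 (l. 2090); proof of Prop. 4.13 Case 1 (l. 2131–2137, p. 48).
* [BorelJacquet1979] A. Borel, H. Jacquet, PSPM 33.1 (1979), §4.1, §4.6.
-/

set_option Elab.async false
set_option autoImplicit false

noncomputable section

open NumberField MeasureTheory IsDedekindDomain
open scoped Matrix Kronecker ComplexOrder ENNReal

namespace Literature.NumberTheory.Automorphic.Liu2021

open _root_.MeasureTheory
open Literature.NumberTheory.Automorphic Literature.NumberTheory.Automorphic.UnitaryGroup
open Literature.NumberTheory.Automorphic.UnitaryGroup.CotangentForms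
open Literature.NumberTheory.Automorphic.IdeleClassGroup
open Literature.NumberTheory.Automorphic.Liu2021.Def411WeilCarriers
open Literature.NumberTheory.Automorphic.Liu2021.Def411WeilCarriersDoubling
open Literature.NumberTheory.GelbartRogawski1991 Literature.NumberTheory.GelbartRogawski1991.UnitaryDualPair
open Literature.NumberTheory.Weil1964
open Literature.RepresentationTheory.Liu2021
open Literature.RepresentationTheory.CompactGroups
open Literature.RepresentationTheory.HeisenbergGroup

/-! ## §1 `χ̃ = chiQuot a χ` for the theta character of a holomorphic-cotangent `P` -/

section Hol

variable (L : Type) [Field L] [NumberField L] [IsCMField L] (ι : L →+* ℂ) (H : Matrix (Fin 3) (Fin 3) L) (T : GL (Fin 3) ℂ)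
  (hT : (T : Matrix (Fin 3) (Fin 3) ℂ)ᴴ * H.map ι * (T : Matrix (Fin 3) (Fin 3) ℂ) = Literature.Geometry.ComplexHyperbolic.BallModel.J)
  {n' : ℕ} (e₁ : Fin 3 × Fin 1 ≃ Fin n') (dV : Fin 3 → L) (hdV : ∀ i, IsCMField.complexConj L (dV i) = dV i)
  (hdV0 : ∀ i, dV i ≠ 0) (g : GL (Fin 3) L)
  (hg : ((g : Matrix (Fin 3) (Fin 3) L).map (cmConjRingHom L))ᵀ * H * (g : Matrix (Fin 3) (Fin 3) L) = Matrix.diagonal dV)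
  (μ : Literature.NumberTheory.Automorphic.IdeleClassGroup L →ₜ* Circle) (hμ : IsConjugateSymplectic L μ) (a : (↥(maximalRealSubfield L))ˣ)
  (hρ : HasThetaMajorants fun
      (p : ↥(UnitaryGroup.adelic (↥(maximalRealSubfield L)) L (IsCMField.complexConj L) 3 (Matrix.diagonal dV)) × ↥(UnitaryGroup.adelic (↥(maximalRealSubfield L)) L (IsCMField.complexConj L) 1 (JW (↥(maximalRealSubfield L)) L a))) (Φ : piSchwartzBruhat (↥(maximalRealSubfield L)) (Fin n')) => (pairRep (↥(maximalRealSubfield L)) L (IsCMField.complexConj L) 3 1 e₁ (Matrix.diagonal dV) (JW (↥(maximalRealSubfield L)) L a)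
          (chiSplittingLine L e₁ dV hdV hdV0 (toHeckeCharacter L μ) (isUnitary_toHeckeCharacter L μ)
            ((isOscillatorChar_toHeckeCharacter_iff μ).mpr hμ) (TW (↥(maximalRealSubfield L)) a)
            (isUnit_det_TW (↥(maximalRealSubfield L)) a) (JW (↥(maximalRealSubfield L)) L a) (JW_eq (↥(maximalRealSubfield L)) L a))) p Φ)

variable
  [CompactSpace (↥(UnitaryGroup.adelic (↥(maximalRealSubfield L)) L (IsCMField.complexConj L) 3 (Matrix.diagonal dV)) ⧸ (UnitaryGroup.toAdelic (↥(maximalRealSubfield L)) L (IsCMField.complexConj L) 3 (Matrix.diagonal dV)).range)] [MeasurableSpace (↥(UnitaryGroup.adelic (↥(maximalRealSubfield L)) L (IsCMField.complexConj L) 1 (JW (↥(maximalRealSubfield L)) L a)) ⧸ (UnitaryGroup.toAdelic (↥(maximalRealSubfield L)) L (IsCMField.complexConj L) 1 (JW (↥(maximalRealSubfield L)) L a)).range)] (μW : Measure (↥(UnitaryGroup.adelic (↥(maximalRealSubfield L)) L (IsCMField.complexConj L) 1 (JW (↥(maximalRealSubfield L)) L a)) ⧸ (UnitaryGroup.toAdelic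 (↥(maximalRealSubfield L)) L (IsCMField.complexConj L) 1 (JW (↥(maximalRealSubfield L)) L a)).range))
  (Φ : piSchwartzBruhat (↥(maximalRealSubfield L)) (Fin n'))

variable [BorelSpace (↥(UnitaryGroup.adelic (↥(maximalRealSubfield L)) L (IsCMField.complexConj L) 1 (JW (↥(maximalRealSubfield L)) L a)) ⧸ (UnitaryGroup.toAdelic (↥(maximalRealSubfield L)) L (IsCMField.complexConj L) 1 (JW (↥(maximalRealSubfield L)) L a)).range)] [IsFiniteMeasure μW]
  [SMulInvariantMeasure ↥(UnitaryGroup.adelic (↥(maximalRealSubfield L)) L (IsCMField.complexConj L) 1 (JW (↥(maximalRealSubfield L)) L a)) (↥(UnitaryGroup.adelic (↥(maximalRealSubfield L)) L (IsCMField.complexConj L) 1 (JW (↥(maximalRealSubfield L)) L a)) ⧸ (UnitaryGroup.toAdelic (↥(maximalRealSubfield L)) L (IsCMField.complexConj L) 1 (JW (↥(maximalRealSubfield L)) L a)).range) μW]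

set_option maxHeartbeats 1600000 in
/-- **The theta character of a holomorphic-cotangent `P` descends to Liu's `χ ∈ Chi`** [Liu2021, l. 2136–2137 + Def. 4.11]: in (C♯)hol's
frame, if `P` contains a non-zero coordinate class of a holomorphic cotangent form and `pr_P [Θ̃_Φ(χ̃) ∘ ιA] ≠ 0`, then `χ̃ = chiQuot a χ`
for some `χ ∈ Chi L⁺ L c̄` (★ `charCM_archCentre_eq_one_of_holCotForm` + ★ `exists_chi_chiQuot_eq_of_archUnit`).
[cite: Liu2021, proof of Prop. 4.13 Case 1 (l. 2136–2137); Def. 4.11 (l. 2090)] [cite: BorelJacquet1979, §4.6] -/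
theorem exists_chi_chiQuot_eq_of_holCotForm
    [CompactSpace (adelicGroupData (↥(maximalRealSubfield L)) L (IsCMField.complexConj L) 3 H).automorphicQuotient]
    (ν : Measure (adelicGroupData (↥(maximalRealSubfield L)) L (IsCMField.complexConj L) 3 H).automorphicQuotient)
    [(adelicGroupData (↥(maximalRealSubfield L)) L (IsCMField.complexConj L) 3 H).IsAutomorphicMeasure ν]
    (P : DiscreteAutomorphicRep (adelicGroupData (↥(maximalRealSubfield L)) L (IsCMField.complexConj L) 3 H) ν)
    {Φh : (adelicGroupData (↥(maximalRealSubfield L)) L (IsCMField.complexConj L) 3 H).Adelic → (Fin 2 → ℂ)}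
    (hΦh : Φh ∈ holCotForms (↥(maximalRealSubfield L)) L (IsCMField.complexConj L) 3 H (cmArchSection L ι H T hT)
      (cmCompactFactor L ι H T hT))
    {j : Fin 2} (hj : MemLp (toQuotFun (adelicGroupData (↥(maximalRealSubfield L)) L (IsCMField.complexConj L) 3 H) fun x => Φh x j) 2 ν)
    (hjmem : hj.toLp _ ∈ P.space.toSubmodule) (hjne : hj.toLp _ ≠ 0) :
    haveI := normal_range_toAdelic_JW L a
    ∀ (χ : PontryaginDual (↥(UnitaryGroup.adelic (↥(maximalRealSubfield L)) L (IsCMField.complexConj L) 1 (JW (↥(maximalRealSubfield L)) L a)) ⧸ (UnitaryGroup.toAdelic (↥(maximalRealSubfield L)) L (IsCMField.complexConj L) 1 (JW (↥(maximalRealSubfield L)) L a)).range)),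
      P.space.toSubmodule.starProjection
          (MemLp.toLp _ (memLp_toQuotFun_lineThetaLift L 3 H e₁ dV hdV hdV0 g hg μ hμ a hρ μW Φ (charCM χ) ν 2)) ≠ 0 →
      ∃ χ' : Chi (↥(maximalRealSubfield L)) L (IsCMField.complexConj L),
        chiQuot (↥(maximalRealSubfield L)) L (IsCMField.complexConj L) (Algebra.IsQuadraticExtension.finrank_eq_two _ L)
          (IsCMField.complexConj_ne_one (K := L)) a χ' = χ := by
  haveI := normal_range_toAdelic_JW L a
  intro χ hpr
  exact Def411WeilCarriers.exists_chi_chiQuot_eq_of_archUnit (↥(maximalRealSubfield L)) L (IsCMField.complexConj L) _ _ a χ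
    (charCM_archCentre_eq_one_of_holCotForm (L := L) (ι := ι) (H := H) (T := T) (hT := hT) (e₁ := e₁) (dV := dV) (hdV := hdV)
      (hdV0 := hdV0) (g := g) (hg := hg) (μ := μ) (hμ := hμ) (a := a) (hρ := hρ) (μW := μW) (Φ := Φ) (ν := ν) (P := P) hΦh hj hjmem
      hjne χ hpr)

end Hol

/-! ## §2 Packaged with the seam: `P` meets the theta lift from `⟨a⟩` at a genuine `χ ∈ Chi` -/

section HolSeam

variable (L : Type) [Field L] [NumberField L] [IsCMField L] (ι : L →+* ℂ) (H : Matrix (Fin 3) (Fin 3) L) (T : GL (Fin 3) ℂ)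
  (hT : (T : Matrix (Fin 3) (Fin 3) ℂ)ᴴ * H.map ι * (T : Matrix (Fin 3) (Fin 3) ℂ) = Literature.Geometry.ComplexHyperbolic.BallModel.J)
  {n' : ℕ} (e₁ : Fin 3 × Fin 1 ≃ Fin n') (dV : Fin 3 → L) (hdV : ∀ i, IsCMField.complexConj L (dV i) = dV i)
  (hdV0 : ∀ i, dV i ≠ 0) (g : GL (Fin 3) L)
  (hg : ((g : Matrix (Fin 3) (Fin 3) L).map (cmConjRingHom L))ᵀ * H * (g : Matrix (Fin 3) (Fin 3) L) = Matrix.diagonal dV)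
  (μ : Literature.NumberTheory.Automorphic.IdeleClassGroup L →ₜ* Circle) (hμ : IsConjugateSymplectic L μ) (a : (↥(maximalRealSubfield L))ˣ)

variable
  [CompactSpace (↥(UnitaryGroup.adelic (↥(maximalRealSubfield L)) L (IsCMField.complexConj L) 3 (Matrix.diagonal dV)) ⧸ (UnitaryGroup.toAdelic (↥(maximalRealSubfield L)) L (IsCMField.complexConj L) 3 (Matrix.diagonal dV)).range)]

set_option maxHeartbeats 1600000 in
/-- **NODE B through step (5): a holomorphic-cotangent `P` meeting the theta lift from the line `⟨a⟩` meets it AT A GENUINE `χ ∈ Chi`** —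
for some majorant witness, measure, `Φ` and `χ ∈ Chi L⁺ L c̄`, the projection to `P` of the class `[Θ̃_Φ(charCM (chiQuot a χ)) ∘ ιA]` is
non-zero (★ `MeetsThetaLiftFromLine.exists_charCM_starProjection_ne_zero` + `exists_chi_chiQuot_eq_of_holCotForm`).  This is the input of
node B steps (3)–(4) (`χ`-coinvariant junction, injectivity ⇒ `HasFinComponent P (rhoAtLine … a χ)`).
[cite: Liu2021, proof of Prop. 4.13 Case 1 (l. 2131–2137, p. 48); Def. 4.11 (l. 2090)] -/
theorem MeetsThetaLiftFromLine.exists_chi_starProjection_ne_zero_of_holCotForm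
    {μA : Measure (adelicGroupData (↥(maximalRealSubfield L)) L (IsCMField.complexConj L) 3 H).automorphicQuotient}
    [(adelicGroupData (↥(maximalRealSubfield L)) L (IsCMField.complexConj L) 3 H).IsAutomorphicMeasure μA]
    [CompactSpace (adelicGroupData (↥(maximalRealSubfield L)) L (IsCMField.complexConj L) 3 H).automorphicQuotient]
    (P : DiscreteAutomorphicRep (adelicGroupData (↥(maximalRealSubfield L)) L (IsCMField.complexConj L) 3 H) μA)
    {Φh : (adelicGroupData (↥(maximalRealSubfield L)) L (IsCMField.complexConj L) 3 H).Adelic → (Fin 2 → ℂ)}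
    (hΦh : Φh ∈ holCotForms (↥(maximalRealSubfield L)) L (IsCMField.complexConj L) 3 H (cmArchSection L ι H T hT)
      (cmCompactFactor L ι H T hT))
    {j : Fin 2} (hj : MemLp (toQuotFun (adelicGroupData (↥(maximalRealSubfield L)) L (IsCMField.complexConj L) 3 H) fun x => Φh x j) 2 μA)
    (hjmem : hj.toLp _ ∈ P.space.toSubmodule) (hjne : hj.toLp _ ≠ 0)
    (h : MeetsThetaLiftFromLine L 3 H e₁ dV hdV hdV0 P μ hμ a (cmAdelicFrameTransport L 3 H dV g hg)) :
    letI : MeasurableSpace (↥(UnitaryGroup.adelic (↥(maximalRealSubfield L)) L (IsCMField.complexConj L) 1 (JW (↥(maximalRealSubfield L)) L a)) ⧸ (UnitaryGroup.toAdelic (↥(maximalRealSubfield L)) L (IsCMField.complexConj L) 1 (JW (↥(maximalRealSubfield L)) L a)).range) := borel _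
    haveI := normal_range_toAdelic_JW L a
    ∃ (hρ : HasThetaMajorants fun
      (p : ↥(UnitaryGroup.adelic (↥(maximalRealSubfield L)) L (IsCMField.complexConj L) 3 (Matrix.diagonal dV)) × ↥(UnitaryGroup.adelic (↥(maximalRealSubfield L)) L (IsCMField.complexConj L) 1 (JW (↥(maximalRealSubfield L)) L a))) (Φ : piSchwartzBruhat (↥(maximalRealSubfield L)) (Fin n')) =>
        pairRep (↥(maximalRealSubfield L)) L (IsCMField.complexConj L) 3 1 e₁ (Matrix.diagonal dV) (JW (↥(maximalRealSubfield L)) L a)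
          (chiSplittingLine L e₁ dV hdV hdV0 (toHeckeCharacter L μ) (isUnitary_toHeckeCharacter L μ)
            ((isOscillatorChar_toHeckeCharacter_iff μ).mpr hμ) (TW (↥(maximalRealSubfield L)) a)
            (isUnit_det_TW (↥(maximalRealSubfield L)) a) (JW (↥(maximalRealSubfield L)) L a) (JW_eq (↥(maximalRealSubfield L)) L a))
          p Φ) (μW : Measure (↥(UnitaryGroup.adelic (↥(maximalRealSubfield L)) L (IsCMField.complexConj L) 1 (JW (↥(maximalRealSubfield L)) L a)) ⧸ (UnitaryGroup.toAdelic (↥(maximalRealSubfield L)) L (IsCMField.complexConj L) 1 (JW (↥(maximalRealSubfield L)) L a)).range)) (_ : IsFiniteMeasure μW) (_ : SMulInvariantMeasure ↥(UnitaryGroup.adelic (↥(maximalRealSubfield L)) L (IsCMField.complexConj L) 1 (JW (↥(maximalRealSubfield L)) L a)) (↥(UnitaryGroup.adelic (↥(maximalRealSubfield L)) L (IsCMField.complexConj L) 1 (JW (↥(maximalRealSubfield L)) L a)) ⧸ (UnitaryGroup.toAdelic (↥(maximalRealSubfield L)) L (IsCMField.complexConj L) 1 (JW (↥(maximalRealSubfield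 L)) L a)).range) μW)
      (Φ : piSchwartzBruhat (↥(maximalRealSubfield L)) (Fin n')) (χ : Chi (↥(maximalRealSubfield L)) L (IsCMField.complexConj L))
      (hθ : MemLp (toQuotFun (adelicGroupData (↥(maximalRealSubfield L)) L (IsCMField.complexConj L) 3 H) fun x =>
        (lineThetaKernelDatum L 3 e₁ dV hdV hdV0 μ hμ a hρ).thetaLiftFun μW Φ
          (charCM (chiQuot (↥(maximalRealSubfield L)) L (IsCMField.complexConj L) (Algebra.IsQuadraticExtension.finrank_eq_two _ L)
            (IsCMField.complexConj_ne_one (K := L)) a χ)) ((cmAdelicFrameTransport L 3 H dV g hg) x)) 2 μA),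
      P.space.toSubmodule.starProjection (MemLp.toLp _ hθ) ≠ 0 := by
  letI : MeasurableSpace (↥(UnitaryGroup.adelic (↥(maximalRealSubfield L)) L (IsCMField.complexConj L) 1 (JW (↥(maximalRealSubfield L)) L a)) ⧸ (UnitaryGroup.toAdelic (↥(maximalRealSubfield L)) L (IsCMField.complexConj L) 1 (JW (↥(maximalRealSubfield L)) L a)).range) := borel _
  haveI : BorelSpace (↥(UnitaryGroup.adelic (↥(maximalRealSubfield L)) L (IsCMField.complexConj L) 1 (JW (↥(maximalRealSubfield L)) L a)) ⧸ (UnitaryGroup.toAdelic (↥(maximalRealSubfield L)) L (IsCMField.complexConj L) 1 (JW (↥(maximalRealSubfield L)) L a)).range) := ⟨rfl⟩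
  haveI := normal_range_toAdelic_JW L a
  obtain ⟨hρ, μW, hfin, hinv, Φ, χ, hθ, hχ⟩ :=
    h.exists_charCM_starProjection_ne_zero (L := L) (N := 3) (H := H) (e₁ := e₁) (dV := dV) (hdV := hdV) (hdV0 := hdV0) (g := g) (hg := hg)
  obtain ⟨χ', hχ'⟩ := exists_chi_chiQuot_eq_of_holCotForm L ι H T hT e₁ dV hdV hdV0 g hg μ hμ a hρ μW Φ μA P hΦh hj hjmem hjne χ hχ
  subst hχ'
  exact ⟨hρ, μW, hfin, hinv, Φ, χ', hθ, hχ⟩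

end HolSeam

end Literature.NumberTheory.Automorphic.Liu2021

end
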